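import Literature.AnabelianGeometry.EtaleTheta.PiNNRatPrimeCoordinates
import Literature.AnabelianGeometry.EtaleTheta.TemperedFrobenioidCnst
import Literature.AnabelianGeometry.EtaleTheta.RealifiedDivisorMonoidsOfRlfR
import Literature.AnabelianGeometry.EtaleTheta.FrdIVocabulary
import HarnessLib

/-!
# [EtTh] Prop 3.4 (ii) / Def 3.6 (i), `Λ = ℝ`, at `Ÿ`-TYPE objects: the effective-locus clauses HOLD at the infinite
# chain model by the DISCRETE MAXIMUM PRINCIPLE (infinitely many primes, infinitely supported divisors)

MODEL companion (carries the definitions of its witness) in the series `Discharge/Sec3*.lean`, cell abc-iut, sub-DAG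
`plan/L2/SUBDAG-EtTh-Thm37.md`, row «EtTh:Thm3.7(iii)/L10-R», GAP-LEDGER G-w5d130-1 — the case its D-rows leave open
(«objects `Y` with infinitely many primes», i.e. the `Ÿ`-type tempered coverings of [EtTh] §1–§2 whose special fibre is
an INFINITE CHAIN of irreducible components).  S. Mochizuki, *The étale theta function …*, Publ. RIMS **45** (2009)
[EtTh], §1 (the coverings `Ÿ → Y → X`, special fibre a chain of copies of `ℙ¹` indexed by `ℤ`), §3 Def. 3.3 (iii)
p.73, Prop. 3.4 (ii) p.74, Def. 3.6 (i) p.76, Thm. 3.7 (iii) p.79 (PDF) [cite: MochizukiEtTh2009, Prop 3.4 (ii) p.74].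

THE POINT.  Over abstract Def. 3.3 (iii) data neither the `B₀`-level clause of Prop. 3.4 (ii) ("a log-meromorphic
function with effective divisor is constant") nor its `Λ = ℝ` companion `hE` (clause 1 of
`RealifiedDivisorMonoids.Prop34Cnst (ofRlfR dm hpf) cnst`) follows from `ℚ`-primality when divisors are infinitely
supported (`Sec3Prop34CnstOfRlfRSupportNegative.lean`, `Φ₀ = ∏_{ℚ_{≥0}} ℚ_{≥0}`).  What makes both TRUE at the genuine
`Ÿ`-type objects is ONE structural law of non-archimedean potential theory (Poisson–Jensen / the slope formula on the
Berkovich skeleton: for a meromorphic `f`, `−log|f|` is piecewise affine along the skeleton with integer slopes and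
its Laplacian is the retraction of `div(f)`): writing `n_j(f) := ord_{C_j}(f)` (component orders) and
`m_j(f) := ord_{x_j}(f)` (orders at the cusps retracting to `C_j`),
  (L)  `n_{j+1}(f) − 2·n_j(f) + n_{j−1}(f) = −m_j(f)`  for all `j ∈ ℤ`.
THIS FILE builds the CHAIN MODEL over the tree's interfaces — `Prime = components ⊔ cusps ≅ ℤ ⊔ ℤ`,
`Φ₀ := ∏_{ℤ ⊔ ℤ} ℚ_{≥0}` (perf-factorial, every `M^pf_𝔮` a `ℚ`-prime, infinitely supported elements — the SAME
cardinalities and prime types as the negative witness), `B₀ := (ℤ → ℤ)` (all component-order functions `φ`; the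
divisor of `φ` is `(φ, −Δ²φ)` by (L): `D`, `divH`), `F₀ :=` the constant functions — and PROVES: `dm.Prop34` over the
tree's [FrdI] vocabularies (`prop34`: an INTEGER `φ ≥ 0` with `Δ²φ ≤ 0` is constant) and the `Λ = ℝ` clause `hE` at
every object (`eff`: a REAL combination `ψ = Σ r_k φ_k` with `ψ ≥ 0`, `Δ²ψ ≤ 0` is constant, so the effective element
is `ψ(0) • ι(div₀ 𝟙) ∈ ℝ·Φ₀^cnst` — by the joint injectivity of the prime coordinates), hence
`Prop34Cnst (ofRlfR dm hpf) (𝟭 _)` (`prop34Cnst_ofRlfR`) and Thm. 3.7 (iii) for every tempered Frobenioid of monoid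
type `ℝ` over these data (`thm37_iii_withCnst_ofRlfR_chain`).  The engine is the discrete maximum principle
`const_of_concave_of_nonneg` ("a concave function on `ℤ` bounded below is constant").
VERDICT for the v-next Def. 3.3 (iii) interface: record the dual graph of the special fibre on `Prime(Φ₀(Y))` and the
law (L) for `f ∈ B₀(Y)`; then Prop. 3.4 (ii)'s effective-locus clause and `hE` are THEOREMS at `Ÿ`-type objects —
no finiteness, no rationality argument.  The cuspidal/non-cuspidal splitting of Def. 3.3 (not used by `Prop34`/`hE`)
is not modelled (everything declared non-cuspidal).  HONEST FRAMING: a MODEL over the cell's abstract interfaces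
exhibiting the mechanism; (L) is refereed non-archimedean potential theory (Baker–Payne–Rabinoff, "Nonarchimedean
geometry, tropicalization, and metrics on curves", Thm. 5.15; Thuillier), not an [EtTh] claim; nothing here bears on
[IUTchIII] Cor. 3.12.  Seat abc-iut-w6-d046 (gen 2).
-/

noncomputable section

namespace Literature.AnabelianGeometry.EtaleTheta

open CategoryTheory Opposite Literature.AlgebraicGeometry.Frobenioids NNReal

namespace Sec3Prop34CnstOfRlfRChainModel

/-! ### The discrete maximum principle on the infinite chain -/

/-- **A concave function on `ℤ` that is bounded below is constant** (discrete Liouville / maximum principle): if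
`ψ(j+1) − 2ψ(j) + ψ(j−1) ≤ 0` and `ψ ≥ 0` then `ψ(j) = ψ(0)` for all `j`.  The engine behind "a log-meromorphic
function with effective divisor on an `Ÿ`-type object is constant". [cite: MochizukiEtTh2009, Prop 3.4 (ii) p.74] -/
theorem const_of_concave_of_nonneg (ψ : ℤ → ℝ) (hconc : ∀ j, ψ (j + 1) - 2 * ψ j + ψ (j - 1) ≤ 0)
    (hpos : ∀ j, 0 ≤ ψ j) (j : ℤ) : ψ j = ψ 0 := by
  -- the forward differences `d j := ψ (j+1) - ψ j` are non-increasing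
  set d : ℤ → ℝ := fun j => ψ (j + 1) - ψ j with hd
  have hstep : ∀ j, d j ≤ d (j - 1) := by
    intro j
    have h1 := hconc j
    have e : (j - 1 + 1) = j := by ring
    simp only [hd, e]
    linarith
  have hmono : ∀ (a : ℤ) (n : ℕ), d (a + n) ≤ d a := by
    intro a n
    induction n with
    | zero => simp
    | succ n ih =>
      have h1 := hstep (a + (n + 1 : ℕ))
      have e : (a + ((n + 1 : ℕ) : ℤ) - 1) = a + n := by push_cast; ring
      rw [e] at h1
      exact h1.trans ih
  -- every difference vanishes
  have hzero : ∀ j₀, d j₀ = 0 := by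
    intro j₀
    rcases lt_trichotomy (d j₀) 0 with hneg | h0 | hposd
    · -- `d j₀ < 0`: `ψ` tends to `-∞` on the right
      exfalso
      have hfwd : ∀ n : ℕ, ψ (j₀ + 1 + n) ≤ ψ (j₀ + 1) + n * d j₀ := by
        intro n
        induction n with
        | zero => simp
        | succ n ih =>
          have h1 : ψ (j₀ + 1 + (n + 1 : ℕ)) = ψ (j₀ + 1 + n) + d (j₀ + (n + 1 : ℕ)) := by
            simp only [hd]; push_cast; ring_nf
          rw [h1]
          have h2 := hmono j₀ (n + 1)
          push_cast at h2 ⊢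
          nlinarith
      obtain ⟨n, hn⟩ := exists_nat_gt (ψ (j₀ + 1) / (-d j₀))
      have h3 : ψ (j₀ + 1) < n * (-d j₀) := (div_lt_iff₀ (neg_pos.mpr hneg)).mp hn
      have h4 := hpos (j₀ + 1 + n)
      have h5 := hfwd n
      nlinarith
    · exact h0
    · -- `d j₀ > 0`: `ψ` tends to `-∞` on the left
      exfalso
      have hbwd : ∀ n : ℕ, ψ (j₀ - n) ≤ ψ j₀ - n * d j₀ := by
        intro n
        induction n with
        | zero => simp
        | succ n ih =>
          have h1 : ψ (j₀ - (n + 1 : ℕ)) = ψ (j₀ - n) - d (j₀ - n - 1) := by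
            simp only [hd]; push_cast; ring_nf
          rw [h1]
          have h2 := hmono (j₀ - n - 1) (n + 1)
          have e : (j₀ - n - 1 + ((n + 1 : ℕ) : ℤ)) = j₀ := by push_cast; ring
          rw [e] at h2
          push_cast
          nlinarith
      obtain ⟨n, hn⟩ := exists_nat_gt (ψ j₀ / d j₀)
      have h3 : ψ j₀ < n * d j₀ := (div_lt_iff₀ hposd).mp hn
      have h4 := hpos (j₀ - n)
      have h5 := hbwd n
      nlinarith
  -- hence `ψ` is constant
  have hsucc : ∀ i, ψ (i + 1) = ψ i := fun i => sub_eq_zero.mp (hzero i)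
  induction j using Int.induction_on with
  | zero => rfl
  | succ i ih => rw [hsucc, ih]
  | pred i ih =>
    have h1 := hsucc (-(i : ℤ) - 1)
    rw [show (-(i : ℤ) - 1 + 1) = -(i : ℤ) by ring] at h1
    rw [← ih, ← h1]

/-! ### The chain model: primes `= components ⊔ cusps ≅ ℤ ⊔ ℤ`, `Φ₀ = ∏ ℚ_{≥0}`, `B₀ = (ℤ → ℤ)` with the law (L) -/

/-- The prime index set: components `inl j` and cusps `inr j`, `j ∈ ℤ`. [cite: MochizukiEtTh2009, Def 3.3 p.73] -/
abbrev I : Type := ℤ ⊕ ℤ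
/-- `Φ₀ := ∏_{ℤ ⊔ ℤ} ℚ_{≥0}` (multiplicatively). [cite: MochizukiEtTh2009, Def 3.3 p.73] -/
abbrev M : Type := I → Multiplicative ℚ≥0

/-- The discrete Laplacian `Δ²φ(j) := φ(j+1) − 2φ(j) + φ(j−1)`. [cite: MochizukiEtTh2009, Def 3.3 p.73] -/
def lap (φ : ℤ → ℤ) (j : ℤ) : ℤ := φ (j + 1) - 2 * φ j + φ (j - 1)

/-- **The law (L)**: the divisor of the function with component orders `φ` — components `φ(j)`, cusps `−Δ²φ(j)`.
[cite: MochizukiEtTh2009, Def 3.3 p.73] -/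
def D (φ : ℤ → ℤ) : I → ℤ
  | Sum.inl j => φ j
  | Sum.inr j => -lap φ j

/-- `D` at a component. [cite: MochizukiEtTh2009, Def 3.3 p.73] -/
@[simp] theorem D_inl (φ : ℤ → ℤ) (j : ℤ) : D φ (Sum.inl j) = φ j := rfl
/-- `D` at a cusp. [cite: MochizukiEtTh2009, Def 3.3 p.73] -/
@[simp] theorem D_inr (φ : ℤ → ℤ) (j : ℤ) : D φ (Sum.inr j) = -lap φ j := rfl

/-- `D` is additive. [cite: MochizukiEtTh2009, Def 3.3 p.73] -/
theorem D_add (φ ψ : ℤ → ℤ) : D (φ + ψ) = D φ + D ψ := by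
  funext i
  rcases i with j | j
  · rfl
  · simp only [D_inr, Pi.add_apply, lap]
    ring

/-- `D 0 = 0`. [cite: MochizukiEtTh2009, Def 3.3 p.73] -/
theorem D_zero : D (0 : ℤ → ℤ) = 0 := by
  funext i
  rcases i with j | j
  · rfl
  · simp [D_inr, lap]

/-- `D` as an additive homomorphism (multiplicative notation). [cite: MochizukiEtTh2009, Def 3.3 p.73] -/
def DHom : Multiplicative (ℤ → ℤ) →* Multiplicative (I → ℤ) :=
  AddMonoidHom.toMultiplicative
    { toFun := D
      map_zero' := D_zero
      map_add' := D_add }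

/-- `B₀ := (ℤ → ℤ)` (the component-order functions, multiplicatively). [cite: MochizukiEtTh2009, Def 3.3 p.73] -/
abbrev B : Type := Multiplicative (ℤ → ℤ)

/-- `B₀ → Φ₀^gp`, `φ ↦ [D φ]` (the divisor of `φ` under the law (L)). [cite: MochizukiEtTh2009, Def 3.3 p.73] -/
def divH : B →* Algebra.GrothendieckGroup M := PiNNRat.toGpHom.comp DHom

/-- `divH φ = toGp (D φ)`. [cite: MochizukiEtTh2009, Def 3.3 p.73] -/
theorem divH_apply (g : B) : divH g = PiNNRat.toGp (D (Multiplicative.toAdd g)) := rfl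

/-- `F₀ := the constant functions` (the log-meromorphic CONSTANTS: divisor `c · Σ_j C_j`, no cusps).
[cite: MochizukiEtTh2009, Def 3.3 p.73] -/
def consts : Submonoid B where
  carrier := {g | ∃ c : ℤ, Multiplicative.toAdd g = fun _ => c}
  one_mem' := ⟨0, rfl⟩
  mul_mem' := by
    rintro g g' ⟨c, hc⟩ ⟨c', hc'⟩
    refine ⟨c + c', ?_⟩
    rw [toAdd_mul, hc, hc']
    rfl

/-- **The chain data `(Φ₀, B₀, B₀ → Φ₀^gp, F₀)`** over the one-object base category (the cuspidal splitting is not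
modelled: everything non-cuspidal). [cite: MochizukiEtTh2009, Def 3.3 p.73] -/
def dm : DivisorMonoids.{0, 0, 0} (Discrete PUnit.{1}) where
  Φ₀ := (Functor.const _).obj (CommMonCat.of M)
  B₀ := (Functor.const _).obj (CommMonCat.of B)
  isUnit_B₀ _ b := by
    change IsUnit (M := B) b
    exact Group.isUnit _
  div₀ _ := divH
  div₀_natural _ b := by
    change divH b = gpMap (MonoidHom.id M) (divH b)
    rw [gpMap_eq_monGpMap, MonGp.map_id, MonoidHom.id_apply]
  F₀ _ := consts
  F₀_map _ _ hb := hb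
  ncsp₀ _ := ⊤
  csp₀ _ := ⊥
  ncsp₀_map _ _ _ := trivial
  csp₀_map _ x hx := by
    rw [Submonoid.mem_bot] at hx ⊢
    rw [hx, map_one]
  existsUnique_ncsp_csp _ x := by
    refine ⟨(⟨x, trivial⟩, ⟨1, Submonoid.mem_bot.mpr rfl⟩), mul_one x, ?_⟩
    rintro ⟨a, c⟩ h
    have hc : c.1 = 1 := Submonoid.mem_bot.mp c.2
    have ha : a.1 = x := by
      have h' : a.1 * c.1 = x := h
      rwa [hc, mul_one] at h'
    exact Prod.ext (Subtype.ext ha) (Subtype.ext hc)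

/-- `Φ₀(Y) = ∏_{ℤ ⊔ ℤ} ℚ_{≥0}` is perf-factorial at every object. [cite: MochizukiEtTh2009, Prop 3.4 p.74] -/
theorem hpf : ∀ Y : (Discrete PUnit.{1})ᵒᵖ, IsPerfFactorial (dm.Φ₀.obj Y) := fun _ => PiNNRat.isPerfFactorial

/-- Every `Φ₀(Y)^pf_𝔮` is `ℚ`-monoprime (the hypothesis `hQ` of the abstract finite / finite-support theorems).
[cite: MochizukiFrdI2008, Def. 2.4(i) p.47] -/
theorem hQ (Y : Discrete PUnit.{1}) (𝔮 : Primes (Perfection (dm.Φ₀.obj (op Y)))) :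
    IsQMonoprime (PfAt (dm.Φ₀.obj (op Y)) 𝔮) :=
  PiNNRat.isQMonoprime_pfAt 𝔮

/-- **The `B₀`-level effective-locus clause at the chain model**: if `div(φ) = (φ, −Δ²φ)` is effective then `φ` is
constant (integer maximum principle). [cite: MochizukiEtTh2009, Prop 3.4 (ii) p.74] -/
theorem mem_consts_of_divH_eq_of (g : B) (x : M) (hg : divH g = Algebra.GrothendieckGroup.of x) : g ∈ consts := by
  have hnn : ∀ i, 0 ≤ D (Multiplicative.toAdd g) i := PiNNRat.nonneg_of_toGp_eq_of hg
  set φ := Multiplicative.toAdd g with hφ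
  have hconst := const_of_concave_of_nonneg (fun j => (φ j : ℝ))
    (fun j => by
      have h1 := hnn (Sum.inr j)
      rw [D_inr, lap] at h1
      have h2 : ((φ (j + 1) - 2 * φ j + φ (j - 1) : ℤ) : ℝ) ≤ 0 := by exact_mod_cast (by linarith)
      push_cast at h2
      exact h2)
    (fun j => by exact_mod_cast hnn (Sum.inl j))
  refine ⟨φ 0, funext fun j => ?_⟩
  exact_mod_cast hconst j

/-- **Prop. 3.4 for the chain data over the TREE's [FrdI] vocabulary**: `Φ₀` perf-factorial, identity endomorphisms
non-dilating, `Φ₀` a divisorial monoid on the one-object category, and — the clauses with content — kernel and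
effective locus of `B₀ → Φ₀^gp` inside the constants, by the integer maximum principle.
[cite: MochizukiEtTh2009, Prop 3.4 p.74] -/
theorem prop34 (IsRat IsSRat : ((Discrete PUnit.{1})ᵒᵖ ⥤ CommMonCat.{0}) → Prop) :
    dm.Prop34 treeMonoidVocab (treeCatVocab (Discrete PUnit.{1}) IsRat IsSRat) where
  isPerfFactorial Y := hpf Y
  isNonDilating Y f _ := by
    change associatesMap (MonoidHom.id M) = MonoidHom.id _
    ext x
    obtain ⟨m, rfl⟩ := Associates.mk_surjective x
    rw [associatesMap_mk]
    rfl
  isDivisorialOn := by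
    refine ⟨⟨fun α => ⟨fun a b h => h, fun x y h => ?_⟩, fun α _ => Function.bijective_id⟩,
      fun _ => PiNNRat.isDivisorial⟩
    obtain ⟨a, rfl⟩ := Associates.mk_surjective x
    obtain ⟨b, rfl⟩ := Associates.mk_surjective y
    rw [associatesMap_mk, associatesMap_mk] at h
    exact h
  ker_div₀_le_F₀ Y g hg := by
    change divH g = 1 at hg
    exact mem_consts_of_divH_eq_of g 1 (by rw [hg, map_one])
  mem_F₀_of_div₀_mem Y g x hg := mem_consts_of_divH_eq_of g x hg

/-- `Prop34Cnst₀` for the chain data and `cnst := 𝟭` (the one-object base has only identity morphisms).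
[cite: MochizukiEtTh2009, Prop 3.4 (ii) p.74] -/
theorem prop34Cnst₀ : dm.Prop34Cnst₀ (𝟭 (Discrete PUnit.{1})) where
  B₀_map_eq_of_cnst_map_eq g g' _ _ _ := by rw [Subsingleton.elim g g']
  Φ₀_map_eq_of_cnst_map_eq g g' _ _ _ := by rw [Subsingleton.elim g g']
  cnst_map_eq_of_B₀_map_eq g g' _ := Subsingleton.elim _ _

/-! ### The `Λ = ℝ` effective-locus clause `hE` HOLDS at the chain model (real maximum principle) -/

/-- The constant function `𝟙` (component orders all `1`: the uniformiser `ϖ`, `e = 1`). [cite: MochizukiEtTh2009, Def 3.3 p.73] -/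
def unif : B := Multiplicative.ofAdd fun _ => (1 : ℤ)
/-- `𝟙 ∈ F₀`. [cite: MochizukiEtTh2009, Def 3.3 p.73] -/
theorem unif_mem : unif ∈ consts := ⟨1, rfl⟩

/-- The divisor of `𝟙`: `1` at every component, `0` at every cusp. [cite: MochizukiEtTh2009, Def 3.3 p.73] -/
theorem D_unif (i : I) : (D (Multiplicative.toAdd unif) i : ℝ) = Sum.elim (fun _ => (1 : ℝ)) (fun _ => 0) i := by
  rcases i with j | j
  · simp [unif, D_inl]
  · simp [unif, D_inr, lap]

/-- **`hE` at the chain model**: an element of `ℝ·Φ₀^birat(Y)` with effective image in `(Φ₀^rlf)^gp(Y)` lies in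
`ℝ·Φ₀^cnst(Y)` — with infinitely many `ℚ`-primes and infinitely supported divisors; the proof is the REAL maximum
principle for `ψ := Σ_k r_k φ_k` plus the joint injectivity of the prime coordinates.
[cite: MochizukiEtTh2009, Prop 3.4 (ii) p.74] -/
theorem eff (Y : Discrete PUnit.{1})
    (b : Algebra.GrothendieckGroup ((RealifiedDivisorMonoids.realData dm hpf).rlf.obj (op Y))) (x : (hpf (op Y)).Rlf)
    (hb : b ∈ ((RealifiedDivisorMonoids.realData dm hpf).realSpan dm.biratGp).carrier Y)
    (hbx : b = Algebra.GrothendieckGroup.of x) :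
    b ∈ ((RealifiedDivisorMonoids.realData dm hpf).realSpan dm.cnstGp).carrier Y := by
  classical
  -- S1: `b = ∏_k r_k • ι(div₀ g_k)`, `g_k = φ_k ∈ B₀(Y) = (ℤ → ℤ)`
  obtain ⟨n, r, cvec, hcvec, rfl⟩ :=
    RealificationDataLemmas.exists_prod_rsmul_of_mem_realSpan (RealifiedDivisorMonoids.realData dm hpf) dm.biratGp Y hb
  have hg' : ∀ k, ∃ g : dm.B₀.obj (op Y), dm.div₀ (op Y) g = cvec k :=
    fun k => RealifiedDivisorMonoids.Prop34Cnst.exists_div₀_eq_of_mem_biratGp Y (hcvec k)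
  choose g hg using hg'
  simp only [← hg] at hbx ⊢
  set φ : Fin n → ℤ → ℤ := fun k => Multiplicative.toAdd (g k) with hφ
  -- the same product in the home of the prime coordinates
  have hP : ∀ v : Fin n → ℝ,
      (∏ k, (RealifiedDivisorMonoids.realData dm hpf).rsmul Y (v k)
        ((RealifiedDivisorMonoids.realData dm hpf).toRlfGp Y (dm.div₀ (op Y) (g k)))) =
      ∏ k, IsPerfFactorial.Rlf.realSMul PiNNRat.isPerfFactorial (v k) (PiNNRat.ιg (PiNNRat.toGp (D (φ k)))) :=
    fun v => rfl
  -- S2: effectivity ⇒ `0 ≤ Σ_k r_k · D(φ_k)(i)` at every index `i` (read at the prime of `i`)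
  have hbx' : (∏ k, IsPerfFactorial.Rlf.realSMul PiNNRat.isPerfFactorial (r k) (PiNNRat.ιg (PiNNRat.toGp (D (φ k))))) =
      Algebra.GrothendieckGroup.of x := (hP r).symm.trans hbx
  have hnonneg : ∀ i : I, 0 ≤ ∑ k, r k * (D (φ k) i : ℝ) := by
    intro i
    obtain ⟨κ, hκ0, hκ⟩ := PiNNRat.exists_coord_eq_mul_eval
      (Primes.congr PiNNRat.eM (PiMonoprime.primeOf PiNNRat.hP i)) (PiNNRat.chart _)
    have h0 : 0 ≤ Multiplicative.toAdd (PrimeCoord.coordGp PiNNRat.isPerfFactorial _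
        (PiNNRat.chart (Primes.congr PiNNRat.eM (PiMonoprime.primeOf PiNNRat.hP i)))
        (∏ k, IsPerfFactorial.Rlf.realSMul PiNNRat.isPerfFactorial (r k) (PiNNRat.ιg (PiNNRat.toGp (D (φ k)))))) := by
      rw [hbx']
      exact PrimeCoord.coordGp_of_nonneg _ _ x
    rw [PiNNRat.toAdd_coordGp_prod_realSMul_toGp _ _ hκ, PiNNRat.jdx_congr_primeOf] at h0
    exact (mul_nonneg_iff_of_pos_left (NNReal.coe_pos.mpr (pos_iff_ne_zero.mpr hκ0))).mp h0
  -- S3: `ψ := Σ r_k φ_k` is `≥ 0` (components) and concave (cusps, law (L)) ⇒ constant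
  set ψ : ℤ → ℝ := fun j => ∑ k, r k * (φ k j : ℝ) with hψ
  have hψpos : ∀ j, 0 ≤ ψ j := fun j => hnonneg (Sum.inl j)
  have hψlap : ∀ j, ψ (j + 1) - 2 * ψ j + ψ (j - 1) = -∑ k, r k * (D (φ k) (Sum.inr j) : ℝ) := by
    intro j
    simp only [hψ, D_inr, lap]
    push_cast
    rw [Finset.mul_sum, ← Finset.sum_sub_distrib, ← Finset.sum_add_distrib, ← Finset.sum_neg_distrib]
    exact Finset.sum_congr rfl fun k _ => by ring
  have hψconc : ∀ j, ψ (j + 1) - 2 * ψ j + ψ (j - 1) ≤ 0 := fun j => by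
    rw [hψlap]; exact neg_nonpos.mpr (hnonneg (Sum.inr j))
  have hconst : ∀ j, ψ j = ψ 0 := const_of_concave_of_nonneg ψ hψconc hψpos
  -- S4: `b = ψ(0) • ι(div₀ 𝟙)` by the joint injectivity of the prime coordinates
  have heq : (∏ k, (RealifiedDivisorMonoids.realData dm hpf).rsmul Y (r k)
        ((RealifiedDivisorMonoids.realData dm hpf).toRlfGp Y (dm.div₀ (op Y) (g k)))) =
      (RealifiedDivisorMonoids.realData dm hpf).rsmul Y (ψ 0)
        ((RealifiedDivisorMonoids.realData dm hpf).toRlfGp Y (dm.div₀ (op Y) unif)) := by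
    rw [hP r]
    change _ = IsPerfFactorial.Rlf.realSMul PiNNRat.isPerfFactorial (ψ 0)
      (PiNNRat.ιg (PiNNRat.toGp (D (Multiplicative.toAdd unif))))
    refine PrimeCoord.eq_of_coordGp_eq PiNNRat.chart fun 𝔮' => ?_
    obtain ⟨κ, -, hκ⟩ := PiNNRat.exists_coord_eq_mul_eval 𝔮' (PiNNRat.chart 𝔮')
    apply Multiplicative.toAdd.injective
    rw [PiNNRat.toAdd_coordGp_prod_realSMul_toGp _ _ hκ, PrimeCoord.toAdd_coordGp_realSMul]
    change _ = ψ 0 * PiNNRat.X 𝔮' (PiNNRat.chart 𝔮') (PiNNRat.toGp (D (Multiplicative.toAdd unif)))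
    rw [PiNNRat.X_toGp _ _ hκ, D_unif]
    cases hj : PiNNRat.jdx 𝔮' with
    | inl j =>
      -- a component: `κ · ψ(j) = ψ(0) · κ`
      simp only [D_inl, Sum.elim_inl]
      change (κ : ℝ) * ψ j = _
      rw [hconst j]
      ring
    | inr j =>
      -- a cusp: `κ · Σ r_k (−Δ²φ_k)(j) = −κ · Δ²ψ(j) = 0`
      simp only [Sum.elim_inr, mul_zero]
      have h1 : ∑ k, r k * (D (φ k) (Sum.inr j) : ℝ) = 0 := by
        have h2 := hψlap j
        rw [hconst (j + 1), hconst j, hconst (j - 1)] at h2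
        linarith
      rw [h1, mul_zero]
  rw [heq]
  exact Subgroup.subset_closure ⟨ψ 0, dm.div₀ (op Y) unif, dm.mem_cnstGp_of_mem_cnst Y ⟨unif, unif_mem, rfl⟩, rfl⟩

/-- **`Prop34Cnst (ofRlfR dm hpf) (𝟭 _)` HOLDS at the chain model** — all four clauses (clause 1 = `eff`, clauses 2–4
from `Prop34Cnst₀` by abc-iut-w5-d130's `ofRlfR_of_eff`). [cite: MochizukiEtTh2009, Prop 3.4 (ii) p.74] -/
theorem prop34Cnst_ofRlfR : (RealifiedDivisorMonoids.ofRlfR dm hpf).Prop34Cnst (𝟭 (Discrete PUnit.{1})) :=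
  RealifiedDivisorMonoids.Prop34Cnst.ofRlfR_of_eff prop34Cnst₀ fun Y b x hb hbx => eff Y b x hb hbx

/-- **Theorem 3.7 (iii) for every tempered Frobenioid of monoid type `ℝ` over the chain data**, unconditionally
(`hE` is a theorem here). [cite: MochizukiEtTh2009, Thm 3.7 (iii) p.79] -/
theorem thm37_iii_withCnst_ofRlfR_chain {Dc : Type} [Category.{0} Dc] {VD : FrdICatStub.{0, 0, 0} Dc}
    (C₀ : TemperedFrobenioid (RealifiedDivisorMonoids.ofRlfR dm hpf) Dc VD) (F : FrobenioidFacade.{0, 0, 0} Dc) :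
    C₀.Thm37_iii (F.withCnst (C₀.base ⋙ 𝟭 (Discrete PUnit.{1}))) :=
  C₀.thm37_iii_withCnst F prop34Cnst_ofRlfR

/-- The chain model has INFINITELY supported divisors: `div(U)`, the coordinate `U` with component orders
`φ(j) = j` (affine, `Δ²φ = 0`, no cusps), is non-zero at every component `j ≠ 0` — so neither the finitely-many-primes
theorem (`Sec3Prop34CnstOfRlfRFinite`) nor the finite-support theorem (`Sec3Prop34CnstOfRlfRSupport`) applies here.
[cite: MochizukiEtTh2009, Def 3.3 p.73] -/
theorem c_divH_coordU (j : ℤ) :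
    PiNNRat.c (Sum.inl j) (divH (Multiplicative.ofAdd fun i : ℤ => i)) = j := by
  rw [divH_apply, PiNNRat.c_toGp]
  rfl

end Sec3Prop34CnstOfRlfRChainModel

end Literature.AnabelianGeometry.EtaleTheta

end
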